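import Literature.NumberTheory.Automorphic.UnitaryGroupCohomologicalForms
import Literature.NumberTheory.Automorphic.UnitaryGroupAdelicProduct
import Literature.NumberTheory.Automorphic.UnitaryGroupArchSection
import Literature.NumberTheory.Automorphic.UnitaryGroupArchProjectionEmb
import Summits.HodgeConjecture.HodgeConjecture.Theorems.H413SpectrumJunction
import Mathlib.Analysis.InnerProductSpace.Continuous
import HarnessLib

/-!
# F0-P2a · line 2 (B4-ARCHIMEDEAN DESK), stub S2β `stub_density : DensityType` — the DENSITY / IRREDUCIBILITY step of the
# orthogonality bootstrap, proved modulo continuity of cohomological cotangent forms (desk support B5)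

Cell hodgecm-mathlib, FLOOR 0; crux item H413 = stmt-HodgeConjecture-24833 (route `HCCMUnconditional`); line
`Cruxes/H413/Lines/F0_P2aCohIsotypicLine.lean` (F0P2a-plan (g2), sha16 fe64be0a9875628f), registered stub `stub_density : DensityType`
(:174 / :221).  Seat F0P2a-p05 (g0).  THEOREMS ONLY (no `def`, no instance, no notation, no named-fact hypothesis, no `sorry`).
HONEST LABEL: HC_CM is proved only modulo the 7 printed citations until rung 0 closes; this file discharges none of them.

## What is proved
* §1 (generic unitary datum `U(J)`, any archimedean section `ιinf : U(2,1) →* U(J)(𝔸_F)` and compact factor `Kc` admitting the product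
  decomposition `x = ιinf u · k · (1, g)`): **`eq_zero_of_archOrth`** — for a discrete automorphic representation `P`, a non-zero
  `U(J)(𝔸_{F,f})`-stable space `N` of CONTINUOUS `(1,0) ⊕ (0,1)` cohomological cotangent forms contained in `P`, and a continuous cohomological
  cotangent form `Φ₃` contained in `P`: if every archimedean translate `R(ιinf u)[Φ]ⱼ` of every coordinate class of every `Φ ∈ N` is orthogonal
  to every coordinate class `[Φ₃]ⱼ'`, then `Φ₃ = 0`.  Proof: the subspace `W = {v ∈ P ∣ ∀ x, ⟪R(x) v, [Φ₃]ⱼ'⟫ = 0}` of `P` is CLOSED and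
  `R`-INVARIANT; by the product decomposition, right `Kc`-invariance of cohomological forms and `U(J)(𝔸_{F,f})`-stability of `N` (transport ★
  `SpectrumJunction.toLp_toQuotFun_mul_right`: right translation of forms is `R` on classes) it contains the classes of `N`, one of which is
  non-zero (★ `toLp_toQuotFun_ne_zero`: continuity + `μ` positive on opens); topological irreducibility of `P` (★ `isTopIrreducible_iff`) gives
  `W = P ∋ [Φ₃]ⱼ'`, so `⟪[Φ₃]ⱼ', [Φ₃]ⱼ'⟫ = 0`; continuity again gives `Φ₃ = 0` ([BorelJacquet1979, §4.6]; [GelfandGraevPiatetskiShapiro1969,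
  Ch. 1 §2.3]).
* §2 (the CM frame `(L, ι, H, T, hT)` of the line): the product decomposition `U(H)(𝔸_{L⁺}) = cmArchSection(U(2,1)) · cmCompactFactor ·
  U(H)(𝔸_{L⁺,f})` (`exists_eq_cmArchSection_mul`, the recipe of ★ `P4StubT1ArchFactor.archFactorOf_isHonest` clause (6) at a general frame:
  ★ `archToAdelic_mul_finAdelicToAdelic`, ★ `archProjU21EmbCM_archPart_archSectionU21CM`), and the corollary
  **`densityType_of_continuous`**: the registered body of `DensityType` (abbreviations `𝒰 / Gf / Rf / coh` of the line unfolded — the line file is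
  not importable — so the closer is defeq to `DensityType` by `δ`) FROM the continuity of the cohomological cotangent forms of the frame
  (desk support B5, F0P2a-p03; at the pin this is ★ `P2StubU2lL2Realisation.continuous_of_mem_cohForms`).
The by-name closer `stub_density_holds` is the one-line application of `densityType_of_continuous` to B5 once B5 is in the tree.

## References
* [BorelJacquet1979] A. Borel, H. Jacquet, *Automorphic forms and automorphic representations*, PSPM 33.1 (1979), §4.1 (`G(𝔸) = G_∞ × G(𝔸_f)`),
  §4.6 (the discrete spectrum).
* [GelfandGraevPiatetskiShapiro1969] I. M. Gelfand, M. I. Graev, I. I. Piatetski-Shapiro, *Representation theory and automorphic functions* (1969),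
  Ch. 1 §2.3 (closed invariant subspaces of `L²` of a compact quotient).
* [PlatonovRapinchuk1994] V. Platonov, A. Rapinchuk, *Algebraic groups and number theory* (1994), §5.1.
* Tree: ★ `Theorems/H413SpectrumJunction` (`toLp_toQuotFun_mul_right`, `toLp_toQuotFun_ne_zero`, `leftInvariant_of_mem_cohForms`),
  ★ `Automorphic/UnitaryGroupCohomologicalForms` (carriers, `cmArchSection`, `cmCompactFactor`), ★ `Automorphic/HilbertRepSpectrum`
  (`ClosedSubrep`, `isTopIrreducible_iff`), ★ `Automorphic/UnitaryGroupAdelicProduct`, `UnitaryGroupArchSection`, `UnitaryGroupArchProjectionEmb`.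
-/

set_option autoImplicit false

-- the mandated namespace has the single-problem summit's repeated segment (`HodgeConjecture.HodgeConjecture`)
set_option linter.dupNamespace false

noncomputable section

namespace Summit.HodgeConjecture.HodgeConjecture.Cruxes.H413.F0P2aStubDensity

open MeasureTheory NumberField Topology
open scoped InnerProductSpace ENNReal ComplexOrder Matrix
open Literature.NumberTheory.Automorphic Literature.NumberTheory.Automorphic.UnitaryGroup
open Literature.NumberTheory.Automorphic.UnitaryGroup.CotangentForms (toQuotFun cmArchSection cmCompactFactor mem_holCotForms_iff)
open Literature.Geometry.ComplexHyperbolic.BallModel (U21)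
open Summit.HodgeConjecture.HodgeConjecture.Cruxes.H413.SpectrumJunction

/-! ## §0 Right `Kc`-invariance of cohomological cotangent forms; the regular representation on right-invariant classes -/

section Invariance

variable {F E : Type} [Field F] [NumberField F] [Field E] [NumberField E] [Algebra F E]
  {c : E ≃ₐ[F] E} {N : ℕ} {J : Matrix (Fin N) (Fin N) E}
  {ιinf : U21 →* (adelicGroupData F E c N J).Adelic} {Kc : Subgroup (adelicGroupData F E c N J).Adelic}

/-- Holomorphic cotangent forms are right-`Kc`-invariant (conjunct (ii) of ★ `holCotForms`). [cite: BorelJacquet1979, §4.2] -/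
theorem apply_mul_of_mem_holCotForms {Φ : (adelicGroupData F E c N J).Adelic → (Fin 2 → ℂ)}
    (hΦ : Φ ∈ CotangentForms.holCotForms F E c N J ιinf Kc) {k : (adelicGroupData F E c N J).Adelic} (hk : k ∈ Kc)
    (x : (adelicGroupData F E c N J).Adelic) : Φ (x * k) = Φ x :=
  (mem_holCotForms_iff.mp hΦ).2.1 k hk x

/-- Cohomological (`(1,0) ⊕ (0,1)`) cotangent forms are right-`Kc`-invariant. [cite: BorelJacquet1979, §4.2] [cite: BorelWallach2000, VII 2.10] -/
theorem apply_mul_of_mem_cohForms {Φ : (adelicGroupData F E c N J).Adelic → (Fin 2 → ℂ)}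
    (hΦ : Φ ∈ CotangentForms.cohForms F E c N J ιinf Kc) {k : (adelicGroupData F E c N J).Adelic} (hk : k ∈ Kc)
    (x : (adelicGroupData F E c N J).Adelic) : Φ (x * k) = Φ x := by
  obtain ⟨a, ha, b, hb, rfl⟩ := Submodule.mem_sup.mp hΦ
  obtain ⟨b', hb', rfl⟩ := Submodule.mem_map.mp hb
  simp only [Pi.add_apply, CotangentForms.conjFun_apply, apply_mul_of_mem_holCotForms ha hk x,
    apply_mul_of_mem_holCotForms hb' hk x]

end Invariance

section Classes

variable {K : Type} [Field K] [NumberField K] {𝒢 : AdelicGroupData.{0} K}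
  {μ : Measure 𝒢.automorphicQuotient} [SMulInvariantMeasure 𝒢.Adelic 𝒢.automorphicQuotient μ]

/-- **`R(k)` fixes the class of a right-`k`-invariant form**: for `Φ` left-`A_G·G(K)`-invariant with `Φ (x k) = Φ x` and `[Φ] ∈ L²`,
`R(k) [Φ] = [Φ]` (the transport identity ★ `toLp_toQuotFun_mul_right` at a fixed vector). [cite: BorelJacquet1979, §4.6] -/
theorem rightRegular_toLp_of_apply_mul {Φ : 𝒢.Adelic → ℂ} (hleft : ∀ γ ∈ 𝒢.quotientSubgroup, ∀ g, Φ (γ * g) = Φ g)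
    (k : 𝒢.Adelic) (hk : ∀ x, Φ (x * k) = Φ x) (hmem : MemLp (toQuotFun 𝒢 Φ) 2 μ) :
    𝒢.rightRegular μ k (hmem.toLp (toQuotFun 𝒢 Φ)) = hmem.toLp (toQuotFun 𝒢 Φ) := by
  have hfun : (fun x => Φ (x * k)) = Φ := funext hk
  have hmemk : MemLp (toQuotFun 𝒢 fun x => Φ (x * k)) 2 μ := by
    rw [hfun]
    exact hmem
  rw [← toLp_toQuotFun_mul_right hleft k hmem hmemk]
  exact MemLp.toLp_congr _ _ (Filter.EventuallyEq.of_eq (by rw [hfun]))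

end Classes

/-! ## §1 The density / irreducibility step for a general archimedean factor `(ιinf, Kc)` with product decomposition -/

section Generic

variable {F E : Type} [Field F] [NumberField F] [Field E] [NumberField E] [Algebra F E]
  {c : E ≃ₐ[F] E} {N : ℕ} {J : Matrix (Fin N) (Fin N) E}
  {μ : Measure (adelicGroupData F E c N J).automorphicQuotient} [(adelicGroupData F E c N J).IsAutomorphicMeasure μ]

/-- **S2β, generic form — density / irreducibility.**  `ιinf : U(2,1) →* U(J)(𝔸_F)` an archimedean section and `Kc ≤ U(J)(𝔸_F)` with the
product decomposition `x = ιinf u · k · (1, g)` (`k ∈ Kc`, `g ∈ U(J)(𝔸_{F,f})`); `P` a discrete automorphic representation; `N` a NON-ZERO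
`U(J)(𝔸_{F,f})`-stable space of continuous cohomological cotangent forms for `(ιinf, Kc)` contained in `P`; `Φ₃` a continuous cohomological
cotangent form contained in `P`.  If `⟪R(ιinf u)[Φ]ⱼ, [Φ₃]ⱼ'⟫ = 0` for all `Φ ∈ N`, `u`, `j`, `j'`, then `Φ₃ = 0`: the closed `R`-invariant
subspace `{v ∈ P ∣ ∀ x, ⟪R(x) v, [Φ₃]ⱼ'⟫ = 0}` contains the (non-zero) classes of `N` — `R(ιinf u · k · (1,g))[Φ]ⱼ = R(ιinf u)[R_g Φ]ⱼ` by right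
`Kc`-invariance and the transport identity — hence is all of the topologically irreducible `P`, which contains `[Φ₃]ⱼ'`; so `[Φ₃]ⱼ' = 0` and,
`Φ₃` being continuous and `μ` positive on open sets, `Φ₃ = 0`. [cite: BorelJacquet1979, §4.6] [cite: GelfandGraevPiatetskiShapiro1969, Ch. 1 §2.3] -/
theorem eq_zero_of_archOrth (ιinf : U21 →* (adelicGroupData F E c N J).Adelic) (Kc : Subgroup (adelicGroupData F E c N J).Adelic)
    (hfac : ∀ x : (adelicGroupData F E c N J).Adelic, ∃ (u : U21) (k : (adelicGroupData F E c N J).Adelic) (g : finAdelic F E c N J),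
      k ∈ Kc ∧ x = ιinf u * k * finAdelicToAdelic F E c N J g)
    (P : DiscreteAutomorphicRep (adelicGroupData F E c N J) μ)
    (N' : Submodule ℂ ((adelicGroupData F E c N J).Adelic → (Fin 2 → ℂ))) (hN : N' ≤ CotangentForms.cohForms F E c N J ιinf Kc)
    (hNP : ∀ Φ ∈ N', P.ContainsForm Φ) (hNst : ∀ (g : finAdelic F E c N J), ∀ Φ ∈ N', CotangentForms.rightRep F E c N J g Φ ∈ N')
    (hN0 : N' ≠ ⊥) (hcontN : ∀ Φ ∈ N', Continuous Φ)
    (Φ₃ : (adelicGroupData F E c N J).Adelic → (Fin 2 → ℂ)) (hΦ₃ : Φ₃ ∈ CotangentForms.cohForms F E c N J ιinf Kc)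
    (hP₃ : P.ContainsForm Φ₃) (hcont₃ : Continuous Φ₃)
    (horth : ∀ Φ ∈ N', ∀ (hΦ : ∀ j : Fin 2, MemLp (toQuotFun (adelicGroupData F E c N J) fun x => Φ x j) 2 μ)
        (h₃ : ∀ j : Fin 2, MemLp (toQuotFun (adelicGroupData F E c N J) fun x => Φ₃ x j) 2 μ),
      ∀ (u : U21) (j j' : Fin 2),
        ⟪(adelicGroupData F E c N J).rightRegular μ (ιinf u) ((hΦ j).toLp (toQuotFun (adelicGroupData F E c N J) fun x => Φ x j)),
          (h₃ j').toLp (toQuotFun (adelicGroupData F E c N J) fun x => Φ₃ x j')⟫_ℂ = 0) :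
    Φ₃ = 0 := by
  -- coordinate functions of cohomological forms: left-invariant
  have hleft : ∀ {Φ : (adelicGroupData F E c N J).Adelic → (Fin 2 → ℂ)}, Φ ∈ CotangentForms.cohForms F E c N J ιinf Kc →
      ∀ (j : Fin 2), ∀ γ ∈ (adelicGroupData F E c N J).quotientSubgroup, ∀ x,
        (fun x => Φ x j) (γ * x) = (fun x => Φ x j) x :=
    fun hΦ j γ hγ x => by simp only [leftInvariant_of_mem_cohForms hΦ γ hγ x]
  have h₃ : ∀ j : Fin 2, MemLp (toQuotFun (adelicGroupData F E c N J) fun x => Φ₃ x j) 2 μ := fun j => (hP₃ j).choose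
  have h₃P : ∀ j : Fin 2, (h₃ j).toLp (toQuotFun (adelicGroupData F E c N J) fun x => Φ₃ x j) ∈ P.space.toSubmodule :=
    fun j => (hP₃ j).choose_spec
  -- it suffices that every coordinate CLASS of `Φ₃` vanishes (continuity, measure positive on opens)
  suffices hcls : ∀ j' : Fin 2, (h₃ j').toLp (toQuotFun (adelicGroupData F E c N J) fun x => Φ₃ x j') = 0 by
    funext x j'
    by_contra hne
    have hne' : (fun y => Φ₃ y j') ≠ 0 := fun h0 => hne (by simpa using congrFun h0 x)
    exact toLp_toQuotFun_ne_zero (hleft hΦ₃ j') ((continuous_apply j').comp hcont₃) (h₃ j') hne' (hcls j')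
  intro j'
  set d : (adelicGroupData F E c N J).L2 μ := (h₃ j').toLp (toQuotFun (adelicGroupData F E c N J) fun x => Φ₃ x j') with hd
  have hdP : d ∈ P.space.toSubmodule := h₃P j'
  -- the closed `R`-invariant subspace `W = {v ∈ P ∣ ∀ x, ⟪R(x) v, d⟫ = 0}` of `P`
  let W : ContRepresentation.ClosedSubrep P.space.toContRep :=
    { toSubmodule :=
        { carrier := {v : P.space.toSubmodule |
            ∀ x : (adelicGroupData F E c N J).Adelic, ⟪(adelicGroupData F E c N J).rightRegular μ x (v : (adelicGroupData F E c N J).L2 μ), d⟫_ℂ = 0}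
          add_mem' := fun {a b} ha hb x => by
            simp only [Submodule.coe_add, map_add, inner_add_left, ha x, hb x, add_zero]
          zero_mem' := fun x => by
            simp only [Submodule.coe_zero, map_zero, inner_zero_left]
          smul_mem' := fun r a ha x => by
            simp only [Submodule.coe_smul, map_smul, inner_smul_left, ha x, mul_zero] }
      apply_mem_toSubmodule := fun g a ha x => by
        show ⟪(adelicGroupData F E c N J).rightRegular μ x
          ((P.space.toContRep g a : P.space.toSubmodule) : (adelicGroupData F E c N J).L2 μ), d⟫_ℂ = 0
        rw [ContRepresentation.ClosedSubrep.coe_toContRep_apply, ← mul_apply_eq_comp, ← map_mul]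
        exact ha (x * g)
      isClosed' := by
        show IsClosed {v : P.space.toSubmodule |
            ∀ x : (adelicGroupData F E c N J).Adelic, ⟪(adelicGroupData F E c N J).rightRegular μ x (v : (adelicGroupData F E c N J).L2 μ), d⟫_ℂ = 0}
        have hset : {v : P.space.toSubmodule | ∀ x : (adelicGroupData F E c N J).Adelic,
              ⟪(adelicGroupData F E c N J).rightRegular μ x (v : (adelicGroupData F E c N J).L2 μ), d⟫_ℂ = 0} =
            ⋂ x : (adelicGroupData F E c N J).Adelic, {v : P.space.toSubmodule |
              ⟪(adelicGroupData F E c N J).rightRegular μ x (v : (adelicGroupData F E c N J).L2 μ), d⟫_ℂ = 0} := by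
          ext v
          simp only [Set.mem_setOf_eq, Set.mem_iInter]
        rw [hset]
        refine isClosed_iInter fun x => isClosed_eq ?_ continuous_const
        exact (((adelicGroupData F E c N J).rightRegular μ x).continuous.comp continuous_subtype_val).inner continuous_const }
  have memW : ∀ v : P.space.toSubmodule, v ∈ W ↔
      ∀ x : (adelicGroupData F E c N J).Adelic, ⟪(adelicGroupData F E c N J).rightRegular μ x (v : (adelicGroupData F E c N J).L2 μ), d⟫_ℂ = 0 :=
    fun v => Iff.rfl
  -- the classes of `N` lie in `W`
  have hclsW : ∀ Φ ∈ N', ∀ (j : Fin 2) (hΦ : MemLp (toQuotFun (adelicGroupData F E c N J) fun x => Φ x j) 2 μ)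
      (hΦP : hΦ.toLp (toQuotFun (adelicGroupData F E c N J) fun x => Φ x j) ∈ P.space.toSubmodule),
      (⟨hΦ.toLp (toQuotFun (adelicGroupData F E c N J) fun x => Φ x j), hΦP⟩ : P.space.toSubmodule) ∈ W := by
    intro Φ hΦN j hΦ hΦP
    rw [memW]
    intro x
    obtain ⟨u, k, g, hk, rfl⟩ := hfac x
    rw [map_mul, map_mul, mul_apply_eq_comp, mul_apply_eq_comp]
    -- `R(1, g) [Φ]ⱼ = [R_g Φ]ⱼ`, with `R_g Φ ∈ N`
    have hΨN : CotangentForms.rightRep F E c N J g Φ ∈ N' := hNst g Φ hΦN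
    have hΨmem : ∀ j : Fin 2, MemLp (toQuotFun (adelicGroupData F E c N J) fun x => CotangentForms.rightRep F E c N J g Φ x j) 2 μ :=
      fun j => ((hNP _ hΨN) j).choose
    have hfun : (toQuotFun (adelicGroupData F E c N J) fun x => CotangentForms.rightRep F E c N J g Φ x j) =
        toQuotFun (adelicGroupData F E c N J) fun x => (fun y => Φ y j) (x * finAdelicToAdelic F E c N J g) := by
      funext y
      simp only [toQuotFun, CotangentForms.rightRep_apply]
    have hmemh : MemLp (toQuotFun (adelicGroupData F E c N J) fun x => (fun y => Φ y j) (x * finAdelicToAdelic F E c N J g)) 2 μ :=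
      hfun ▸ hΨmem j
    have h1 : (adelicGroupData F E c N J).rightRegular μ (finAdelicToAdelic F E c N J g)
          (hΦ.toLp (toQuotFun (adelicGroupData F E c N J) fun x => Φ x j)) =
        (hΨmem j).toLp (toQuotFun (adelicGroupData F E c N J) fun x => CotangentForms.rightRep F E c N J g Φ x j) := by
      rw [← toLp_toQuotFun_mul_right (hleft (hN hΦN) j) _ hΦ hmemh]
      exact MemLp.toLp_congr _ _ (Filter.EventuallyEq.of_eq hfun.symm)
    rw [h1]
    -- `R(k) [R_g Φ]ⱼ = [R_g Φ]ⱼ` by right `Kc`-invariance of cohomological forms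
    rw [rightRegular_toLp_of_apply_mul (hleft (hN hΨN) j) k
      (fun x => by simp only [apply_mul_of_mem_cohForms (hN hΨN) hk x]) (hΨmem j)]
    -- the archimedean translate is orthogonal to `d` by hypothesis
    exact horth _ hΨN hΨmem h₃ u j j'
  -- a non-zero class of `N` (so `W ≠ ⊥`)
  obtain ⟨Φ, hΦN, hΦne⟩ := (Submodule.ne_bot_iff N').mp hN0
  obtain ⟨x, j, hxj⟩ : ∃ (x : (adelicGroupData F E c N J).Adelic) (j : Fin 2), Φ x j ≠ 0 := by
    by_contra h
    push Not at h
    exact hΦne (funext fun x => funext fun j => h x j)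
  have hΦjne : (fun y => Φ y j) ≠ 0 := fun h0 => hxj (by simpa using congrFun h0 x)
  have hΦmem : ∀ j : Fin 2, MemLp (toQuotFun (adelicGroupData F E c N J) fun x => Φ x j) 2 μ := fun j => ((hNP Φ hΦN) j).choose
  have hΦmemP : ∀ j : Fin 2, (hΦmem j).toLp (toQuotFun (adelicGroupData F E c N J) fun x => Φ x j) ∈ P.space.toSubmodule :=
    fun j => ((hNP Φ hΦN) j).choose_spec
  have hvne : (hΦmem j).toLp (toQuotFun (adelicGroupData F E c N J) fun y => Φ y j) ≠ 0 :=
    toLp_toQuotFun_ne_zero (hleft (hN hΦN) j) ((continuous_apply j).comp (hcontN Φ hΦN)) (hΦmem j) hΦjne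
  have hvW := hclsW Φ hΦN j (hΦmem j) (hΦmemP j)
  -- topological irreducibility of `P`: `W = ⊥` or `W = ⊤`
  obtain ⟨-, hsimple⟩ := (ContRepresentation.isTopIrreducible_iff _).mp P.irreducible
  rcases hsimple W with hbot | htop
  · exfalso
    rw [hbot, ContRepresentation.ClosedSubrep.mem_bot] at hvW
    exact hvne (congrArg Subtype.val hvW)
  · have hdW : (⟨d, hdP⟩ : P.space.toSubmodule) ∈ W := by
      rw [htop]
      exact ContRepresentation.ClosedSubrep.mem_top _
    have h0 := (memW _).mp hdW 1
    rw [map_one, one_apply_eq_self] at h0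
    exact inner_self_eq_zero.mp h0

end Generic

/-! ## §2 The CM frame `(L, ι, H, T, hT)`: product decomposition and the registered stub body modulo continuity (B5) -/

section CMFrame

variable (L : Type) [Field L] [NumberField L] [IsCMField L] (ι : L →+* ℂ) (H : Matrix (Fin 3) (Fin 3) L) (T : GL (Fin 3) ℂ)
  (hT : (T : Matrix (Fin 3) (Fin 3) ℂ)ᴴ * H.map ι * (T : Matrix (Fin 3) (Fin 3) ℂ) = Literature.Geometry.ComplexHyperbolic.BallModel.J)

/-- Unfolding of the CM archimedean section: `cmArchSection u = ((un-twist (T u T⁻¹) at w(ι), 1 elsewhere), 1_f)` (`rfl`).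
[cite: BorelJacquet1979, §4.1] -/
theorem cmArchSection_apply (u : U21) :
    cmArchSection L ι H T hT u = archToAdelic (↥(maximalRealSubfield L)) L (IsCMField.complexConj L) 3 H
      (archSingle (↥(maximalRealSubfield L)) L (IsCMField.complexConj L) 3 H (IsCMField.complexConj_ne_one L)
        (complexConj_smul_infinitePlace L) (cmPlace L ι)
        (archLocalOfEmb L 3 H ι (isComplex_mk_of_isCMField L ι)
          ((formEquivU21 L H ι T (formCongr_eq_of_conjTranspose L ι H T hT)).symm u))) :=
  rfl

/-- The finite-adelic component of `cmArchSection u` is trivial. [cite: BorelJacquet1979, §4.1] -/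
theorem finPart_cmArchSection (u : U21) :
    finPart (↥(maximalRealSubfield L)) L (IsCMField.complexConj L) 3 H (cmArchSection L ι H T hT u) = 1 := by
  rw [cmArchSection_apply]
  exact finPart_archToAdelic _ _ _ _ _ _

/-- `cmArchSection u = (its archimedean component, 1)`. [cite: BorelJacquet1979, §4.1] -/
theorem archToAdelic_archPart_cmArchSection (u : U21) :
    archToAdelic (↥(maximalRealSubfield L)) L (IsCMField.complexConj L) 3 H
        (archPart (↥(maximalRealSubfield L)) L (IsCMField.complexConj L) 3 H (cmArchSection L ι H T hT u)) =
      cmArchSection L ι H T hT u := by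
  rw [cmArchSection_apply, archPart_archToAdelic]

/-- The CM section is a right inverse of the archimedean projection at `ι` through the frame (★ `archProjU21EmbCM_archPart_archSectionU21CM`,
retyped). [cite: BorelJacquet1979, §4.1] -/
theorem archProjU21EmbCM_archPart_cmArchSection (u : U21) :
    archProjU21EmbCM L H ι T (formCongr_eq_of_conjTranspose L ι H T hT)
        (archPart (↥(maximalRealSubfield L)) L (IsCMField.complexConj L) 3 H (cmArchSection L ι H T hT u)) = u :=
  archProjU21EmbCM_archPart_archSectionU21CM L ι H T hT u

/-- **The `K_c`-part of an archimedean element** for the CM frame: `(a, 1) = cmArchSection (pr_ι a) · k` with `k ∈ cmCompactFactor`.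
[cite: BorelJacquet1979, §4.1] [cite: PlatonovRapinchuk1994, §5.1] -/
theorem exists_mem_cmCompactFactor_archToAdelic_eq
    (a : arch (↥(maximalRealSubfield L)) L (IsCMField.complexConj L) 3 H) :
    ∃ k ∈ cmCompactFactor L ι H T hT, archToAdelic (↥(maximalRealSubfield L)) L (IsCMField.complexConj L) 3 H a =
      cmArchSection L ι H T hT (archProjU21EmbCM L H ι T (formCongr_eq_of_conjTranspose L ι H T hT) a) * k := by
  refine ⟨archToAdelic (↥(maximalRealSubfield L)) L (IsCMField.complexConj L) 3 H
      ((archPart (↥(maximalRealSubfield L)) L (IsCMField.complexConj L) 3 H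
        (cmArchSection L ι H T hT (archProjU21EmbCM L H ι T (formCongr_eq_of_conjTranspose L ι H T hT) a)))⁻¹ * a), ?_, ?_⟩
  · rw [CotangentForms.cmCompactFactor_eq]
    refine Subgroup.mem_map_of_mem _ ?_
    rw [MonoidHom.mem_ker, map_mul, map_inv, archProjU21EmbCM_archPart_cmArchSection, inv_mul_cancel]
  · rw [map_mul, map_inv, archToAdelic_archPart_cmArchSection, mul_inv_cancel_left]

/-- **Product decomposition of `U(H)(𝔸_{L⁺})` for the CM frame**: every `x` is `cmArchSection u · k · (1, g)` with `k ∈ cmCompactFactor`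
(`u = pr_ι (x_∞)`, `g = x_f`). [cite: BorelJacquet1979, §4.1] [cite: PlatonovRapinchuk1994, §5.1] -/
theorem exists_eq_cmArchSection_mul (x : (adelicGroupData (↥(maximalRealSubfield L)) L (IsCMField.complexConj L) 3 H).Adelic) :
    ∃ (u : U21) (k : (adelicGroupData (↥(maximalRealSubfield L)) L (IsCMField.complexConj L) 3 H).Adelic)
      (g : finAdelic (↥(maximalRealSubfield L)) L (IsCMField.complexConj L) 3 H),
      k ∈ cmCompactFactor L ι H T hT ∧
        x = cmArchSection L ι H T hT u * k * finAdelicToAdelic (↥(maximalRealSubfield L)) L (IsCMField.complexConj L) 3 H g := by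
  obtain ⟨k, hk, hdec⟩ := exists_mem_cmCompactFactor_archToAdelic_eq L ι H T hT
    (archPart (↥(maximalRealSubfield L)) L (IsCMField.complexConj L) 3 H x)
  refine ⟨archProjU21EmbCM L H ι T (formCongr_eq_of_conjTranspose L ι H T hT)
      (archPart (↥(maximalRealSubfield L)) L (IsCMField.complexConj L) 3 H x), k,
    finPart (↥(maximalRealSubfield L)) L (IsCMField.complexConj L) 3 H x, hk, ?_⟩
  rw [← hdec]
  exact (archToAdelic_mul_finAdelicToAdelic (↥(maximalRealSubfield L)) L (IsCMField.complexConj L) 3 H x).symm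

end CMFrame

/-- **S2β modulo B5 — the registered body of `DensityType` from continuity of cohomological cotangent forms of the frame.**
For the CM datum `(L, ι, H, T, hT)` (`H` of signature `(2,1)` at `ι` through the frame `T`, definite at the other places, `[L⁺:ℚ] ≥ 2`),
an automorphic measure `μ`, a discrete automorphic `P`, a non-zero `U(H)(𝔸_{L⁺,f})`-stable space `N` of cohomological cotangent forms contained
in `P`, and a cohomological cotangent form `Φ₃` contained in `P` all of whose coordinate classes are orthogonal to all archimedean translates of
the coordinate classes of `N`: `Φ₃ = 0` — GIVEN that the cohomological cotangent forms of every such frame are continuous on `U(H)(𝔸_{L⁺})`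
(desk support B5; at the pin ★ `P2StubU2lL2Realisation.continuous_of_mem_cohForms`).  The conclusion is the body of the line's `DensityType`
with its reducible abbreviations `𝒰 / Gf / Rf / coh` unfolded. [cite: BorelJacquet1979, §4.6] [cite: GelfandGraevPiatetskiShapiro1969, Ch. 1 §2.3] -/
theorem densityType_of_continuous
    (hcont : ∀ (L : Type) [Field L] [NumberField L] [IsCMField L] (ι : L →+* ℂ) (H : Matrix (Fin 3) (Fin 3) L) (T : GL (Fin 3) ℂ)
      (hT : (T : Matrix (Fin 3) (Fin 3) ℂ)ᴴ * H.map ι * (T : Matrix (Fin 3) (Fin 3) ℂ) = Literature.Geometry.ComplexHyperbolic.BallModel.J),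
      (∀ τ' : L →+* ℂ, InfinitePlace.mk τ' ≠ InfinitePlace.mk ι → (H.map τ').PosDef) →
      ∀ Φ ∈ CotangentForms.cohForms (↥(maximalRealSubfield L)) L (IsCMField.complexConj L) 3 H (cmArchSection L ι H T hT)
        (cmCompactFactor L ι H T hT), Continuous Φ) :
    ∀ (L : Type) [Field L] [NumberField L] [IsCMField L] (ι : L →+* ℂ) (H : Matrix (Fin 3) (Fin 3) L) (T : GL (Fin 3) ℂ)
      (hT : (T : Matrix (Fin 3) (Fin 3) ℂ)ᴴ * H.map ι * (T : Matrix (Fin 3) (Fin 3) ℂ) = Literature.Geometry.ComplexHyperbolic.BallModel.J),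
      (∀ τ' : L →+* ℂ, InfinitePlace.mk τ' ≠ InfinitePlace.mk ι → (H.map τ').PosDef) →
      2 ≤ Module.finrank ℚ ↥(maximalRealSubfield L) →
      ∀ (μ : Measure (adelicGroupData (↥(maximalRealSubfield L)) L (IsCMField.complexConj L) 3 H).automorphicQuotient)
        [(adelicGroupData (↥(maximalRealSubfield L)) L (IsCMField.complexConj L) 3 H).IsAutomorphicMeasure μ]
        (P : DiscreteAutomorphicRep (adelicGroupData (↥(maximalRealSubfield L)) L (IsCMField.complexConj L) 3 H) μ)
        (N : Submodule ℂ ((adelicGroupData (↥(maximalRealSubfield L)) L (IsCMField.complexConj L) 3 H).Adelic → (Fin 2 → ℂ))),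
        N ≤ CotangentForms.cohForms (↥(maximalRealSubfield L)) L (IsCMField.complexConj L) 3 H (cmArchSection L ι H T hT)
          (cmCompactFactor L ι H T hT) →
      (∀ Φ ∈ N, P.ContainsForm Φ) →
      (∀ (g : finAdelic (↥(maximalRealSubfield L)) L (IsCMField.complexConj L) 3 H), ∀ Φ ∈ N,
        CotangentForms.rightRep (↥(maximalRealSubfield L)) L (IsCMField.complexConj L) 3 H g Φ ∈ N) → N ≠ ⊥ →
      ∀ Φ₃ ∈ CotangentForms.cohForms (↥(maximalRealSubfield L)) L (IsCMField.complexConj L) 3 H (cmArchSection L ι H T hT)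
        (cmCompactFactor L ι H T hT), P.ContainsForm Φ₃ →
      (∀ Φ ∈ N, ∀ (hΦ : ∀ j : Fin 2, MemLp (toQuotFun (adelicGroupData (↥(maximalRealSubfield L)) L (IsCMField.complexConj L) 3 H)
            fun x => Φ x j) 2 μ)
          (h₃ : ∀ j : Fin 2, MemLp (toQuotFun (adelicGroupData (↥(maximalRealSubfield L)) L (IsCMField.complexConj L) 3 H)
            fun x => Φ₃ x j) 2 μ),
        ∀ (u : Literature.Geometry.ComplexHyperbolic.BallModel.U21) (j j' : Fin 2),
          ⟪(adelicGroupData (↥(maximalRealSubfield L)) L (IsCMField.complexConj L) 3 H).rightRegular μ (cmArchSection L ι H T hT u)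
              ((hΦ j).toLp (toQuotFun (adelicGroupData (↥(maximalRealSubfield L)) L (IsCMField.complexConj L) 3 H) fun x => Φ x j)),
            (h₃ j').toLp (toQuotFun (adelicGroupData (↥(maximalRealSubfield L)) L (IsCMField.complexConj L) 3 H)
              fun x => Φ₃ x j')⟫_ℂ = 0) →
      Φ₃ = 0 := by
  intro L _ _ _ ι H T hT hdef _h2 μ _ P N hN hNP hNst hN0 Φ₃ hΦ₃ hP₃ horth
  exact eq_zero_of_archOrth (cmArchSection L ι H T hT) (cmCompactFactor L ι H T hT) (exists_eq_cmArchSection_mul L ι H T hT) P N hN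
    hNP hNst hN0 (fun Φ hΦ => hcont L ι H T hT hdef Φ (hN hΦ)) Φ₃ hΦ₃ hP₃ (hcont L ι H T hT hdef Φ₃ hΦ₃) horth

end Summit.HodgeConjecture.HodgeConjecture.Cruxes.H413.F0P2aStubDensity

end
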